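import Summits.HodgeConjecture.HodgeConjecture.Theorems.WeilTwelvefoldsSqrtMinus7.Negative.EigenvalueTyping
import Summits.HodgeConjecture.HodgeConjecture.Theorems.WeilTwelvefoldsSqrtMinus7.Negative.WeilPlaneReality
import Literature.AlgebraicGeometry.HodgeTheory.AbelianVarietyEndomorphismsHOne
import Literature.AlgebraicGeometry.Motives.AbelianVarietyCohomologyExteriorH1
import HarnessLib

/-!
# Crux `WeilSixfoldsSqrtMinus7` (stmt-HodgeConjecture-1260), line `hyperbolic-eightfold-descent` — the typed eigenspace of `(𝟙 + φ)^*` on `H^{2n}` is the Weil line (G3, part 1)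

Route `HeckePrymWeil`, sub-goal G3 (`stub_weilSignature`) of Stub 7 (aimed partner at `d = 7`).
The crux types the Weil plane of `(A, φ)`, `φ ≫ φ = -7`, by the SINGLE operator `(𝟙 + φ)^*` on
`H^{2n}(A(ℂ); ℂ)`: `Eig((𝟙+φ)^*, (1+i√7)^{2n}) ⊔ Eig((𝟙+φ)^*, (1-i√7)^{2n})`. This file proves that
each typed eigenspace IS the Weil line `⋀^{2n} V_μ` (`μ = ± i√7`, `V_μ = ker(φ^* - μ)` on `H¹`):
given `2n` independent `μ`-eigenvectors `e₊` and `2n` independent `(-μ)`-eigenvectors `e₋` of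
`φ^*` on `H¹(A(ℂ); ℂ)` (`b₁ = 4n`), `Eig((𝟙+φ)^*, (1 + μ)^{2n}) = ℂ · (e₊,₀ ∪ ⋯ ∪ e₊,₂ₙ₋₁)`
(`eigenspace_one_add_eq_span_cupPowOne`). Proof, after the tree's
`finrank_pullbackEigenclasses_pow_eq_one` (which types by ALL test endomorphisms `x·𝟙 + y·φ`): in
the wedge basis `b_S` (`|S| = 2n`) of the eigenbasis `b = e₊ ⊔ e₋` of `H¹`
(`H^{2n} = ⋀^{2n} H¹`, `abelianVarietyCohomologyExteriorH1_holds`), `(𝟙 + φ)^*` is diagonal with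
character `∏_{i ∈ S} (1 + λᵢ)` (multiplicativity, `map_cupPowOne`), and
`(1 + i√7)ᵃ (1 - i√7)ᵇ = (1 + i√7)^{a+b}` only for `b = 0` — no eigenvalue collision for `√-7`
(`Negative.mixed_eq_plus_iff`, `Negative.mixed_eq_minus_iff`: `(1-i√7)/(1+i√7)` is no root of
unity) — so the joint-eigenvector lemma `forall_apply_eq_smul_iff_mem_span_singleton` pins the
eigenspace to the line through `b_{S₀}`, `S₀ =` the `μ`-indices.

Source: B. van Geemen, LNM 1594 (1994), 4.9–4.10 and proof of Lemma 5.2 (6) ("the cases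
`a = 0, 2n` give `⋀^{2n} W` and `⋀^{2n} W^*`"). Everything from theorems of the tree; no named fact.
-/

noncomputable section

-- single-problem summit (Problem = Summit): the mandated namespace repeats `HodgeConjecture`.
set_option linter.dupNamespace false

open CategoryTheory Module
open scoped Matrix ComplexConjugate
open Literature.AlgebraicGeometry Literature.AlgebraicGeometry.Motives
  Literature.AlgebraicGeometry.HodgeTheory Literature.AlgebraicTopology.SingularHomology
  Literature.Geometry.Kaehler

namespace Summit.HodgeConjecture.HodgeConjecture.Theorems.WeilSixfoldsSqrtMinus7.HyperbolicEightfoldDescent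

section EigenLine

open Summit.HodgeConjecture.HodgeConjecture.Theorems.WeilTwelvefoldsSqrtMinus7.Negative

/-- **The typed eigenspace of `(𝟙 + φ)^*` on `H^{2n}` is the Weil line `⋀^{2n} V_μ`** for
`K = ℚ(√-7)`: for `μ = ± i√7`, `2n` independent `μ`-eigenvectors `e₊` and `2n` independent
`(-μ)`-eigenvectors `e₋` of `φ^*` on `H¹(A(ℂ); ℂ)` (`b₁ = 4n`), the eigenspace of `(𝟙 + φ)^*` on
`H^{2n}(A(ℂ); ℂ) = ⋀^{2n} H¹` for `(1 + μ)^{2n}` is the line through `e₊,₀ ∪ ⋯ ∪ e₊,₂ₙ₋₁`: in the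
wedge basis `b_S` of the eigenbasis `b = e₊ ⊔ e₋`, `(𝟙 + φ)^* b_S = ∏_{i ∈ S} (1 + λᵢ) · b_S`
(multiplicativity), and `(1 + i√7)ᵃ (1 - i√7)ᵇ = (1 + i√7)^{a+b}` forces `b = 0` (no eigenvalue
collision for `√-7`, `mixed_eq_plus_iff` / `mixed_eq_minus_iff`).
[cite: vanGeemen1994HodgeAV, 4.9–4.10 and proof of Lemma 5.2 (6)] -/
theorem eigenspace_one_add_eq_span_cupPowOne :
    ∀ (A : AbelianVariety ℂ) (n : ℕ) (φ : A ⟶ A),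
      Module.finrank ℂ (complexBetti A.X 1) = 2 * n + 2 * n →
      ∀ (μ : ℂ), (μ = Complex.I * ((Real.sqrt (7 : ℝ) : ℝ) : ℂ) ∨
          μ = -(Complex.I * ((Real.sqrt (7 : ℝ) : ℝ) : ℂ))) →
      ∀ (ep em : Fin (2 * n) → complexBetti A.X 1), LinearIndependent ℂ ep → LinearIndependent ℂ em →
      (∀ i, ep i ∈ Module.End.eigenspace (complexBetti.map φ.hom.hom.hom 1).hom μ) →
      (∀ i, em i ∈ Module.End.eigenspace (complexBetti.map φ.hom.hom.hom 1).hom (-μ)) →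
      Module.End.eigenspace (complexBetti.map (𝟙 A + φ).hom.hom.hom (2 * n)).hom ((1 + μ) ^ (2 * n)) =
        ℂ ∙ cupPowOne ℂ (ComplexPoints A.X) (2 * n) ep := by
  intro A n φ hb₁ μ hμ ep em hep hem hepμ hemμ
  classical
  haveI := finite_complexBetti_abelianVariety A 1
  have hφ1 : 𝟙 A + φ = (1 : ℕ) • 𝟙 A + (1 : ℕ) • φ := by rw [one_nsmul, one_nsmul]
  rw [hφ1]
  set T := (complexBetti.map φ.hom.hom.hom 1).hom with hT
  have hs0 : Complex.I * ((Real.sqrt (7 : ℝ) : ℝ) : ℂ) ≠ 0 := mul_ne_zero Complex.I_ne_zero sqrt7_ne_zero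
  have hμ0 : μ ≠ 0 := by
    rcases hμ with rfl | rfl
    · exact hs0
    · exact neg_ne_zero.2 hs0
  -- the eigenbasis `b = ep ⊔ em` of `H¹`, the `μ`-vectors first
  have hdisj : Disjoint (Submodule.span ℂ (Set.range ep)) (Submodule.span ℂ (Set.range em)) := by
    have hμμ : μ ≠ -μ := fun h => hμ0 (by linear_combination (1 / 2 : ℂ) * h)
    refine Disjoint.mono (Submodule.span_le.2 ?_) (Submodule.span_le.2 ?_)
      (Submodule.disjoint_def.2 fun x h1 h2 => eq_zero_of_mem_eigenspace_of_mem_eigenspace T hμμ h1 h2)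
    · rintro _ ⟨i, rfl⟩
      exact hepμ i
    · rintro _ ⟨i, rfl⟩
      exact hemμ i
  have hind : LinearIndependent ℂ (Sum.elim ep em) := hep.sum_type hem hdisj
  have hsp : ⊤ ≤ Submodule.span ℂ (Set.range (Sum.elim ep em)) :=
    (hind.span_eq_top_of_card_eq_finrank' (by rw [Fintype.card_sum, Fintype.card_fin, hb₁])).ge
  let b₀ : Module.Basis (Fin (2 * n) ⊕ Fin (2 * n)) ℂ (complexBetti A.X 1) := Module.Basis.mk hind hsp
  have hb₀ : ∀ x, b₀ x = Sum.elim ep em x := fun x => Module.Basis.mk_apply hind hsp x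
  let b : Module.Basis (Fin (2 * n + 2 * n)) ℂ (complexBetti A.X 1) := b₀.reindex finSumFinEquiv
  let lam : Fin (2 * n + 2 * n) → ℂ := fun i =>
    Sum.elim (fun _ => μ) (fun _ => -μ) (finSumFinEquiv.symm i)
  have hlam : ∀ i, lam i = μ ∨ lam i = -μ := fun i => by
    change Sum.elim (fun _ => μ) (fun _ => -μ) (finSumFinEquiv.symm i) = μ ∨
      Sum.elim (fun _ => μ) (fun _ => -μ) (finSumFinEquiv.symm i) = -μ
    rcases finSumFinEquiv.symm i with k | k
    · exact Or.inl rfl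
    · exact Or.inr rfl
  have hb_mem : ∀ i, b i ∈ Module.End.eigenspace T (lam i) := by
    intro i
    rw [Module.Basis.reindex_apply, hb₀]
    change Sum.elim ep em (finSumFinEquiv.symm i) ∈
      Module.End.eigenspace T (Sum.elim (fun _ => μ) (fun _ => -μ) (finSumFinEquiv.symm i))
    rcases finSumFinEquiv.symm i with k | k
    · exact hepμ k
    · exact hemμ k
  -- the wedge basis of `H^{2n}` and the action of `(𝟙 + φ)^*` on it
  have hΛ : HasExteriorCohomologyH1 ℂ (ComplexPoints A.X) :=
    abelianVarietyCohomologyExteriorH1_holds.hasExteriorCohomologyH1 A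
  let Bw : Module.Basis (Set.powersetCard (Fin (2 * n + 2 * n)) (2 * n)) ℂ (complexBetti A.X (2 * n)) :=
    (b.exteriorPower (2 * n)).map (hΛ.equiv (2 * n))
  have hBw : ∀ S, Bw S = cupPowOne ℂ (ComplexPoints A.X) (2 * n)
      (b ∘ (Set.powersetCard.ofFinEmbEquiv.symm S)) := by
    intro S
    change hΛ.equiv (2 * n) ((b.exteriorPower (2 * n)) S) = _
    rw [exteriorPower.basis_apply, HasExteriorCohomologyH1.equiv_apply, exteriorPower.ιMulti_family,
      wedgeToCup_ιMulti]
  set L := (complexBetti.map ((1 : ℕ) • 𝟙 A + (1 : ℕ) • φ).hom.hom.hom (2 * n)).hom with hL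
  have hact : ∀ S : Set.powersetCard (Fin (2 * n + 2 * n)) (2 * n),
      L (Bw S) = (∏ i : Fin (2 * n), (((1 : ℕ) : ℂ) + ((1 : ℕ) : ℂ) *
        lam (Set.powersetCard.ofFinEmbEquiv.symm S i))) • Bw S := by
    intro S
    rw [hBw]
    change singularCohomology.map ℂ ℂ
      (AlgPoints.mapContinuous (L := ℂ) ((1 : ℕ) • 𝟙 A + (1 : ℕ) • φ).hom.hom.hom) (2 * n)
        (cupPowOne ℂ _ (2 * n) _) = _
    rw [map_cupPowOne]
    have e : (fun i => singularCohomology.map ℂ ℂ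
        (AlgPoints.mapContinuous (L := ℂ) ((1 : ℕ) • 𝟙 A + (1 : ℕ) • φ).hom.hom.hom) 1
          ((b ∘ (Set.powersetCard.ofFinEmbEquiv.symm S)) i)) =
        fun i => (((1 : ℕ) : ℂ) + ((1 : ℕ) : ℂ) * lam (Set.powersetCard.ofFinEmbEquiv.symm S i)) •
          (b ∘ (Set.powersetCard.ofFinEmbEquiv.symm S)) i := by
      funext i
      exact complexBetti_map_nsmul_id_add_nsmul_one_of_mem_eigenspace (hb_mem _) 1 1
    rw [e, MultilinearMap.map_smul_univ]
  -- the distinguished index: the `2n` vectors of eigenvalue `μ`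
  let S₀ : Set.powersetCard (Fin (2 * n + 2 * n)) (2 * n) :=
    Set.powersetCard.ofFinEmbEquiv (Fin.castAddOrderEmb (2 * n))
  have hS₀ : ∀ i : Fin (2 * n + 2 * n), i ∈ S₀ ↔ ∃ k : Fin (2 * n), Fin.castAdd (2 * n) k = i := by
    intro i
    rw [Set.powersetCard.mem_ofFinEmbEquiv_iff_mem_range]
    rfl
  have hlam_pos : ∀ i, i ∈ S₀ → lam i = μ := by
    intro i hi
    obtain ⟨k, rfl⟩ := (hS₀ i).1 hi
    change Sum.elim (fun _ => μ) (fun _ => -μ) (finSumFinEquiv.symm (Fin.castAdd (2 * n) k)) = μ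
    rw [finSumFinEquiv_symm_apply_castAdd, Sum.elim_inl]
  have hlam_neg : ∀ i, i ∉ S₀ → lam i = -μ := by
    intro i hi
    change Sum.elim (fun _ => μ) (fun _ => -μ) (finSumFinEquiv.symm i) = -μ
    generalize hj : finSumFinEquiv.symm i = j
    rcases j with k | k
    · exfalso
      refine hi ((hS₀ i).2 ⟨k, ?_⟩)
      rw [← finSumFinEquiv_apply_left, ← hj, Equiv.apply_symm_apply]
    · rfl
  -- the characters `∏ (1 + λᵢ)` match `(1 + μ)^{2n}` only at `S₀` (no collision for `√-7`)
  have hχ : ∀ S : Set.powersetCard (Fin (2 * n + 2 * n)) (2 * n),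
      (∏ i : Fin (2 * n), (((1 : ℕ) : ℂ) + ((1 : ℕ) : ℂ) *
        lam (Set.powersetCard.ofFinEmbEquiv.symm S i))) = (1 + μ) ^ (2 * n) ↔ S = S₀ := by
    intro S
    simp only [Nat.cast_one, one_mul]
    constructor
    · intro h
      by_contra hne
      obtain ⟨i, hiS, hiS₀⟩ := (Set.powersetCard.exists_mem_notMem_iff_ne S S₀).1 hne
      obtain ⟨k₀, hk₀⟩ : i ∈ Set.range (Set.powersetCard.ofFinEmbEquiv.symm S) :=
        (Set.powersetCard.mem_range_ofFinEmbEquiv_symm_iff_mem S i).2 hiS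
      set f : Fin (2 * n) → ℂ := fun k => lam (Set.powersetCard.ofFinEmbEquiv.symm S k) with hf
      have hsplit : ∏ k, (1 + f k) =
          (1 + μ) ^ (Finset.univ.filter fun k => f k = μ).card *
            (1 - μ) ^ (Finset.univ.filter fun k => ¬f k = μ).card := by
        rw [← Finset.prod_filter_mul_prod_filter_not Finset.univ (fun k => f k = μ)]
        congr 1
        · refine (Finset.prod_congr rfl fun k hk => ?_).trans (Finset.prod_const _)
          rw [(Finset.mem_filter.1 hk).2]
        · refine (Finset.prod_congr rfl fun k hk => ?_).trans (Finset.prod_const _)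
          rcases hlam (Set.powersetCard.ofFinEmbEquiv.symm S k) with h1 | h1
          · exact absurd h1 (Finset.mem_filter.1 hk).2
          · change 1 + lam (Set.powersetCard.ofFinEmbEquiv.symm S k) = 1 - μ
            rw [h1, sub_eq_add_neg]
      have hcard : (Finset.univ.filter fun k => f k = μ).card +
          (Finset.univ.filter fun k => ¬f k = μ).card = 2 * n := by
        rw [Finset.card_filter_add_card_filter_not, Finset.card_univ, Fintype.card_fin]
      have hpos : 0 < (Finset.univ.filter fun k => ¬f k = μ).card := by
        refine Finset.card_pos.2 ⟨k₀, Finset.mem_filter.2 ⟨Finset.mem_univ _, ?_⟩⟩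
        change ¬lam (Set.powersetCard.ofFinEmbEquiv.symm S k₀) = μ
        rw [hk₀, hlam_neg i hiS₀]
        intro h2
        apply hμ0
        linear_combination (-(1 : ℂ) / 2) * h2
      change ∏ k, (1 + f k) = (1 + μ) ^ (2 * n) at h
      have h' : (1 + μ) ^ (Finset.univ.filter fun k => f k = μ).card *
          (1 - μ) ^ (Finset.univ.filter fun k => ¬f k = μ).card =
          (1 + μ) ^ ((Finset.univ.filter fun k => f k = μ).card +
            (Finset.univ.filter fun k => ¬f k = μ).card) := by
        rw [hcard, ← hsplit]
        exact h
      generalize (Finset.univ.filter fun k => f k = μ).card = a at h' hpos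
      generalize (Finset.univ.filter fun k => ¬f k = μ).card = bb at h' hpos
      rcases hμ with rfl | rfl
      · exact (Nat.pos_iff_ne_zero.1 hpos) ((mixed_eq_plus_iff _ _).1 h')
      · rw [← sub_eq_add_neg, sub_neg_eq_add, mul_comm, Nat.add_comm a bb] at h'
        exact (Nat.pos_iff_ne_zero.1 hpos) ((mixed_eq_minus_iff _ _).1 h')
    · rintro rfl
      rw [Finset.prod_congr rfl (fun i _ => by
        rw [hlam_pos _ ((Set.powersetCard.mem_range_ofFinEmbEquiv_symm_iff_mem S₀ _).1 ⟨i, rfl⟩)]),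
        Finset.prod_const, Finset.card_univ, Fintype.card_fin]
  -- the eigenspace is the line through `Bw S₀`
  have key : Module.End.eigenspace L ((1 + μ) ^ (2 * n)) = ℂ ∙ Bw S₀ := by
    ext c
    rw [Module.End.mem_eigenspace_iff]
    have hiff := forall_apply_eq_smul_iff_mem_span_singleton (P := Unit) Bw (fun _ => L)
      (fun S _ => ∏ i : Fin (2 * n), (((1 : ℕ) : ℂ) + ((1 : ℕ) : ℂ) *
        lam (Set.powersetCard.ofFinEmbEquiv.symm S i)))
      (fun _ S => hact S) (fun _ => (1 + μ) ^ (2 * n)) S₀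
      (fun S => by rw [funext_iff]; simp only [forall_const]; exact hχ S) c
    rw [← hiff]
    exact ⟨fun h _ => h, fun h => h ()⟩
  have hBwS₀ : Bw S₀ = cupPowOne ℂ (ComplexPoints A.X) (2 * n) ep := by
    rw [hBw]
    congr 1
    funext k
    rw [Function.comp_apply, Equiv.symm_apply_apply]
    change b (Fin.castAdd (2 * n) k) = ep k
    rw [Module.Basis.reindex_apply, finSumFinEquiv_symm_apply_castAdd, hb₀, Sum.elim_inl]
  rw [← hBwS₀, ← key]

end EigenLine

end Summit.HodgeConjecture.HodgeConjecture.Theorems.WeilSixfoldsSqrtMinus7.HyperbolicEightfoldDescent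

end
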